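import Summits.CriticalPhenomena.PercolationContinuityZ3.Theorems.SahiGridPatternOrderNStrata

/-!
# The order-`n` pattern functional is symmetric in its slots; the chain row `(1,n)` and nested tuples in any order

Support file (Sahi cell `prim-sahi`, seat `prim-sahi-typer`, generation 26; `--supports stmt-CriticalPhenomena-4575`).  Pure proofs
(bookkeeping definitions: the (axis,value) set `valSet ω` of a configuration, the value-avoiding sums `avoidSum`, the number
`allowed` of admissible values, the Latin configuration `cfg π` of a pattern), no `sorry`, standard axioms.

The recursive kernel `K_n` is NOT symmetric in the slots (e.g. `K_2(M) = M₁₁M₀₁ − M₁₁M₀₀`), but the pattern functional is: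
**`sStarN_comp_perm : sStarN n d (A ∘ σ) = sStarN n d A`** for every `σ ∈ S_n`.  Proof WITHOUT a closed form of the kernel, by
COEFFICIENT EXTRACTION from the symmetric `E_n`: for a set `E` of excluded (axis, value) pairs let
`F_A(E) = Σ_{ω avoiding E} Ssym A ω`; normalising the indicator weights of the allowed values into a product probability weight,
`sahiE_symm` and the symmetry of `sahiE` (`sahiE_comp_perm`, [LiebSahi2021, Def. 3.1]) give `F_{A∘σ}(E) = F_A(E)` (`avoidSum_comp_perm`);
and inclusion–exclusion over `E` isolates the configurations using EVERY value on EVERY axis — the Latin ones, `(n!)^d` of them, each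
contributing exactly `sStarN n d A`:  `(n!)^d · sStarN n d A = Σ_E (−1)^{#E} F_A(E)` (`sStarN_eq_alternating_avoidSum`; the inner
alternating sum is `Finset.sum_powerset_neg_one_pow_card`).
Consequences: the strata of `…OrderNStrata` hold in ANY slot (`sStarN_nonneg_of_mem_univ`, `sStarN_four_nonneg_of_mem_univ`); nested tuples
are good in ANY order (`sStarN_nonneg_of_isChain`); and since the up-sets of a chain are nested, **`patternPosN_dim_one : PatternPosN n 1`
for every `n`** — the row `d = 1` of the order-`n` table (the cells `(1,n)`: Blinovsky's chain theorem, now coefficientwise and kernel-checked).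
[this work]
-/

namespace Summit.CriticalPhenomena.PercolationContinuityZ3.Theorems.SahiGridPatternN

open Finset Literature.Probability.LatticeModels Literature.Combinatorics.Sahi2008
open SahiCopyKernel (copyKernel incMatrix copyKernel_zero)
open scoped BigOperators

noncomputable section

variable {m d : ℕ}

/-! ### Weighted symmetry, from the symmetry of `E_n` -/

/-- For every product probability weight, the weighted configuration sum of `Ssym` is symmetric in the slots (it is `(n!)^d E_n`).
[this work] -/
theorem sum_weight_Ssym_comp_perm {n K : ℕ} (g : Fin d → Fin (K + 1) → ℝ) (hg1 : ∀ a, ∑ u, g a u = 1)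
    (σ : Equiv.Perm (Fin n)) (A : Fin n → Finset (Xd d K)) :
    ∑ ω : Fin n → Xd d K, (∏ c, ∏ a, g a (ω c a)) * (Ssym (fun i => A (σ i)) ω : ℝ) =
      ∑ ω : Fin n → Xd d K, (∏ c, ∏ a, g a (ω c a)) * (Ssym A ω : ℝ) := by
  rw [← sahiE_symm g hg1, ← sahiE_symm g hg1]
  congr 1
  exact sahiE_comp_perm _ n σ (fun i => setInd (A i))

/-! ### Value-avoiding sums -/

/-- `F_A(E) = Σ_{ω avoiding E} Ssym A ω`. [this work] -/
def avoidSum (A : Fin (m + 1) → Finset (Xd d m)) (E : Finset (Fin d × Fin (m + 1))) : ℤ :=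
  ∑ ω : Fin (m + 1) → Xd d m, if (∀ c a, (a, ω c a) ∉ E) then Ssym A ω else 0

/-- Number of allowed values on axis `a`. [this work] -/
def allowed (E : Finset (Fin d × Fin (m + 1))) (a : Fin d) : ℕ := (univ.filter fun u : Fin (m + 1) => (a, u) ∉ E).card

/-- The normalised indicator weight of the allowed values: its `n`-copy product weight is `[ω avoids E] / (∏_a allowed)^{n}`.
[this work] -/
theorem prod_allowedWeight (E : Finset (Fin d × Fin (m + 1))) (ω : Fin (m + 1) → Xd d m) :
    (∏ c, ∏ a, (if (a, ω c a) ∉ E then (1 : ℝ) else 0) / (allowed E a : ℝ)) =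
      (if (∀ c a, (a, ω c a) ∉ E) then (1 : ℝ) else 0) / (∏ a : Fin d, (allowed E a : ℝ)) ^ (m + 1) := by
  have hnum : (∏ c : Fin (m + 1), ∏ a : Fin d, (if (a, ω c a) ∉ E then (1 : ℝ) else 0)) =
      if (∀ c a, (a, ω c a) ∉ E) then 1 else 0 := by
    by_cases h : (∀ c a, (a, ω c a) ∉ E)
    · rw [if_pos h]
      exact Finset.prod_eq_one fun c _ => Finset.prod_eq_one fun a _ => if_pos (h c a)
    · rw [if_neg h]
      push Not at h
      obtain ⟨c, a, hca⟩ := h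
      exact Finset.prod_eq_zero (mem_univ c) (Finset.prod_eq_zero (mem_univ a) (if_neg fun hn => hn hca))
  simp_rw [Finset.prod_div_distrib]
  rw [hnum, Finset.prod_const, Finset.card_univ, Fintype.card_fin]

/-- **`F_A(E)` is symmetric in the slots.** [this work] -/
theorem avoidSum_comp_perm (σ : Equiv.Perm (Fin (m + 1))) (A : Fin (m + 1) → Finset (Xd d m))
    (E : Finset (Fin d × Fin (m + 1))) : avoidSum (fun i => A (σ i)) E = avoidSum A E := by
  by_cases hE : ∃ a, allowed E a = 0
  · -- no configuration avoids `E`: both sides vanish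
    obtain ⟨a, ha⟩ := hE
    have hno : ∀ ω : Fin (m + 1) → Xd d m, ¬ (∀ c a, (a, ω c a) ∉ E) := by
      intro ω hω
      have : ω 0 a ∈ (univ.filter fun u : Fin (m + 1) => (a, u) ∉ E) := by
        rw [mem_filter]; exact ⟨mem_univ _, hω 0 a⟩
      rw [allowed, Finset.card_eq_zero] at ha
      rw [ha] at this
      exact absurd this (Finset.notMem_empty _)
    unfold avoidSum
    simp only [hno, if_false]
  · push Not at hE
    have hpos : ∀ a, 0 < (allowed E a : ℝ) := fun a => by exact_mod_cast Nat.pos_of_ne_zero (hE a)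
    set g : Fin d → Fin (m + 1) → ℝ := fun a u => (if (a, u) ∉ E then (1 : ℝ) else 0) / (allowed E a : ℝ) with hg
    have hg1 : ∀ a, ∑ u, g a u = 1 := by
      intro a
      simp only [hg, ← Finset.sum_div, Finset.sum_boole]
      rw [show ((univ.filter fun u : Fin (m + 1) => (a, u) ∉ E).card : ℝ) = (allowed E a : ℝ) from rfl]
      exact div_self (hpos a).ne'
    have key := sum_weight_Ssym_comp_perm g hg1 σ A
    have hC : (0 : ℝ) < (∏ a : Fin d, (allowed E a : ℝ)) ^ (m + 1) := pow_pos (Finset.prod_pos fun a _ => hpos a) _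
    have hrw : ∀ (B : Fin (m + 1) → Finset (Xd d m)),
        ∑ ω : Fin (m + 1) → Xd d m, (∏ c, ∏ a, g a (ω c a)) * (Ssym B ω : ℝ) =
          (avoidSum B E : ℝ) / (∏ a : Fin d, (allowed E a : ℝ)) ^ (m + 1) := by
      intro B
      unfold avoidSum
      push_cast
      rw [Finset.sum_div]
      refine Finset.sum_congr rfl fun ω _ => ?_
      rw [show (∏ c, ∏ a, g a (ω c a)) = (if (∀ c a, (a, ω c a) ∉ E) then (1 : ℝ) else 0) / (∏ a : Fin d, (allowed E a : ℝ)) ^ (m + 1)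
        from prod_allowedWeight E ω]
      by_cases h : (∀ c a, (a, ω c a) ∉ E)
      · rw [if_pos h, if_pos h]; ring
      · rw [if_neg h, if_neg h]; ring
    rw [hrw, hrw] at key
    have := (div_left_inj' hC.ne').1 key
    exact_mod_cast this

/-! ### Extraction of the Latin configurations by inclusion–exclusion -/

/-- The (axis, value) pairs used by a configuration. [this work] -/
def valSet (ω : Fin (m + 1) → Xd d m) : Finset (Fin d × Fin (m + 1)) :=
  univ.image fun ca : Fin (m + 1) × Fin d => (ca.2, ω ca.1 ca.2)

/-- `ω` avoids `E` iff `E` lies in the complement of its value set. [this work] -/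
theorem avoids_iff_subset_compl (E : Finset (Fin d × Fin (m + 1))) (ω : Fin (m + 1) → Xd d m) :
    (∀ c a, (a, ω c a) ∉ E) ↔ E ⊆ (valSet ω)ᶜ := by
  unfold valSet
  constructor
  · intro h x hx
    rw [mem_compl, mem_image]
    rintro ⟨⟨c, a⟩, _, rfl⟩
    exact h c a hx
  · intro h c a hca
    have := h hca
    rw [mem_compl, mem_image] at this
    exact this ⟨(c, a), mem_univ _, rfl⟩

/-- **Inclusion–exclusion**: `Σ_E (−1)^{#E} [ω avoids E] = [ω uses every value on every axis]`. [this work] -/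
theorem alternating_sum_avoids (ω : Fin (m + 1) → Xd d m) :
    ∑ E ∈ (univ : Finset (Fin d × Fin (m + 1))).powerset, (-1 : ℤ) ^ E.card * (if (∀ c a, (a, ω c a) ∉ E) then 1 else 0) =
      if valSet ω = univ then 1 else 0 := by
  have h1 : ∑ E ∈ (univ : Finset (Fin d × Fin (m + 1))).powerset, (-1 : ℤ) ^ E.card * (if (∀ c a, (a, ω c a) ∉ E) then 1 else 0) =
      ∑ E ∈ ((valSet ω)ᶜ).powerset, (-1 : ℤ) ^ E.card := by
    rw [← Finset.sum_filter_add_sum_filter_not (univ : Finset _).powerset (fun E => (∀ c a, (a, ω c a) ∉ E))]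
    rw [Finset.sum_eq_zero (s := filter (fun E => ¬(∀ c a, (a, ω c a) ∉ E)) _) (fun E hE => by
      rw [mem_filter] at hE; rw [if_neg hE.2, mul_zero]), add_zero]
    have hset : filter (fun E => (∀ c a, (a, ω c a) ∉ E)) (univ : Finset (Fin d × Fin (m + 1))).powerset = ((valSet ω)ᶜ).powerset := by
      ext E
      rw [mem_filter, mem_powerset, mem_powerset, avoids_iff_subset_compl]
      exact ⟨fun h => h.2, fun h => ⟨subset_univ _, h⟩⟩
    rw [hset]
    refine Finset.sum_congr rfl fun E hE => ?_
    rw [mem_powerset, ← avoids_iff_subset_compl] at hE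
    rw [if_pos hE, mul_one]
  rw [h1, Finset.sum_powerset_neg_one_pow_card]
  simp only [compl_eq_empty_iff]

/-- The Latin configuration of a pattern: copy `c` sits at value `π_a c` on axis `a`. [this work] -/
def cfg (π : Fin d → Equiv.Perm (Fin (m + 1))) : Fin (m + 1) → Xd d m := fun c a => π a c

/-- `cfg` is injective. [this work] -/
theorem cfg_injective : Function.Injective (cfg : (Fin d → Equiv.Perm (Fin (m + 1))) → Fin (m + 1) → Xd d m) := by
  intro π π' h
  funext a; ext c
  exact congrArg (fun ω => (ω c a : ℕ)) h

/-- A configuration uses every value on every axis iff it is the Latin configuration of a pattern. [this work] -/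
theorem valSet_eq_univ_iff (ω : Fin (m + 1) → Xd d m) : valSet ω = univ ↔ ∃ π, cfg π = ω := by
  constructor
  · intro h
    have hsurj : ∀ a, Function.Surjective fun c => ω c a := by
      intro a u
      have hu : (a, u) ∈ valSet ω := by rw [h]; exact mem_univ _
      unfold valSet at hu
      rw [mem_image] at hu
      obtain ⟨⟨c, a'⟩, _, hca⟩ := hu
      simp only [Prod.mk.injEq] at hca
      obtain ⟨rfl, hcu⟩ := hca
      exact ⟨c, hcu⟩
    have hbij : ∀ a, Function.Bijective fun c => ω c a := fun a =>
      ⟨Finite.injective_iff_surjective.2 (hsurj a), hsurj a⟩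
    refine ⟨fun a => Equiv.ofBijective _ (hbij a), ?_⟩
    funext c a
    rfl
  · rintro ⟨π, rfl⟩
    refine Finset.eq_univ_of_forall fun ⟨a, u⟩ => ?_
    unfold valSet
    rw [mem_image]
    exact ⟨((π a).symm u, a), mem_univ _, by simp [cfg]⟩

/-- At a Latin configuration, `Ssym` is the pattern functional itself. [this work] -/
theorem Ssym_cfg (A : Fin (m + 1) → Finset (Xd d m)) (π : Fin d → Equiv.Perm (Fin (m + 1))) :
    Ssym A (cfg π) = sStarN (m + 1) d A := by
  unfold Ssym sStarN
  have h : ∀ π' : Fin d → Equiv.Perm (Fin (m + 1)), incMatrix A (Tmap π' (cfg π)) = incMatrix A (col fun a => π a * π' a) := by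
    intro π'; funext i c; rfl
  simp_rw [h]
  exact Fintype.sum_equiv (Equiv.piCongrRight fun a => Equiv.mulLeft (π a)) _ _ fun π' => rfl

/-- **Coefficient extraction**: `((m+1)!)^d · sStarN (m+1) d A = Σ_E (−1)^{#E} F_A(E)`. [this work] -/
theorem sStarN_eq_alternating_avoidSum (A : Fin (m + 1) → Finset (Xd d m)) :
    ((Nat.factorial (m + 1) : ℤ) ^ d) * sStarN (m + 1) d A =
      ∑ E ∈ (univ : Finset (Fin d × Fin (m + 1))).powerset, (-1 : ℤ) ^ E.card * avoidSum A E := by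
  -- right-hand side: swap the sums and apply inclusion–exclusion
  have hR : ∑ E ∈ (univ : Finset (Fin d × Fin (m + 1))).powerset, (-1 : ℤ) ^ E.card * avoidSum A E =
      ∑ ω : Fin (m + 1) → Xd d m, (if valSet ω = univ then 1 else 0) * Ssym A ω := by
    unfold avoidSum
    simp_rw [Finset.mul_sum]
    rw [Finset.sum_comm]
    refine Finset.sum_congr rfl fun ω _ => ?_
    rw [← alternating_sum_avoids ω, Finset.sum_mul]
    refine Finset.sum_congr rfl fun E _ => ?_
    by_cases h : (∀ c a, (a, ω c a) ∉ E) <;> simp [h]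
  rw [hR]
  -- left-hand side: the Latin configurations are the `cfg π`, each contributing `sStarN`
  have hL : ∑ ω : Fin (m + 1) → Xd d m, (if valSet ω = univ then 1 else 0) * Ssym A ω =
      ∑ ω ∈ (univ : Finset (Fin d → Equiv.Perm (Fin (m + 1)))).image cfg, Ssym A ω := by
    rw [← Finset.sum_filter_add_sum_filter_not univ (fun ω : Fin (m + 1) → Xd d m => valSet ω = univ)]
    rw [Finset.sum_eq_zero (s := filter (fun ω => ¬valSet ω = univ) _) (fun ω hω => by
      rw [mem_filter] at hω; rw [if_neg hω.2, zero_mul]), add_zero]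
    have hset : filter (fun ω : Fin (m + 1) → Xd d m => valSet ω = univ) univ =
        (univ : Finset (Fin d → Equiv.Perm (Fin (m + 1)))).image cfg := by
      ext ω
      rw [mem_filter, mem_image, valSet_eq_univ_iff]
      simp only [mem_univ, true_and]
    rw [hset]
    refine Finset.sum_congr rfl fun ω hω => ?_
    rw [mem_image] at hω
    obtain ⟨π, _, rfl⟩ := hω
    rw [if_pos ((valSet_eq_univ_iff _).2 ⟨π, rfl⟩), one_mul]
  rw [hL, Finset.sum_image fun π _ π' _ h => cfg_injective h]
  simp_rw [Ssym_cfg]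
  rw [Finset.sum_const, Finset.card_univ, Fintype.card_pi, Finset.prod_const, Finset.card_univ, Fintype.card_fin,
    Fintype.card_perm, Fintype.card_fin, nsmul_eq_mul]
  push_cast
  ring

/-! ### Symmetry and its consequences -/

/-- **The pattern functional is symmetric in its slots.** [this work] -/
theorem sStarN_comp_perm {n : ℕ} (σ : Equiv.Perm (Fin n)) (A : Fin n → Finset (Pn n d)) :
    sStarN n d (fun i => A (σ i)) = sStarN n d A := by
  cases n with
  | zero =>
      unfold sStarN
      simp [copyKernel_zero]
  | succ m =>
      have h1 := sStarN_eq_alternating_avoidSum (d := d) (fun i => A (σ i))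
      have h2 := sStarN_eq_alternating_avoidSum (d := d) A
      simp_rw [avoidSum_comp_perm σ A] at h1
      rw [← h2] at h1
      have hne : ((Nat.factorial (m + 1) : ℤ) ^ d) ≠ 0 := pow_ne_zero _ (by exact_mod_cast (Nat.factorial_pos _).ne')
      exact mul_left_cancel₀ hne h1

/-- **Empty slot, any position** — restated for convenience (already order-free). [this work] -/
theorem sStarN_eq_zero_of_exists_empty {n : ℕ} (A : Fin n → Finset (Pn n d)) (h : ∃ i, A i = ∅) : sStarN n d A = 0 := by
  obtain ⟨i, hi⟩ := h
  exact sStarN_eq_zero_of_empty A i hi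

/-- **Full slot, ANY position**: given `PatternPosN (n+1) d`, an `(n+2)`-tuple of up-sets of `[n+2]^d` one of which is the whole cube
satisfies the order-`(n+2)` pattern inequality. [this work] -/
theorem sStarN_nonneg_of_mem_univ {n : ℕ} (hP : PatternPosN (n + 1) d) (A : Fin (n + 2) → Finset (Pn (n + 2) d)) (i : Fin (n + 2))
    (hAi : A i = univ) (hA : ∀ j, IsUpperSet (A j : Set (Pn (n + 2) d))) : 0 ≤ sStarN (n + 2) d A := by
  rw [← sStarN_comp_perm (Equiv.swap 0 i) A]
  exact sStarN_nonneg_of_head_univ hP _ (by simp [Equiv.swap_apply_left, hAi]) fun j => hA _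

/-- Unconditional order-4 stratum, any slot: for `d ≤ 3`, every quadruple of up-sets of `[4]^d` one of which is the whole cube satisfies
the order-4 pattern inequality. [this work] -/
theorem sStarN_four_nonneg_of_mem_univ (hd : d ≤ 3) (A : Fin 4 → Finset (Pn 4 d)) (i : Fin 4) (hAi : A i = univ)
    (hA : ∀ j, IsUpperSet (A j : Set (Pn 4 d))) : 0 ≤ sStarN 4 d A :=
  sStarN_nonneg_of_mem_univ (patternPosN_three_of_le_three hd) A i hAi hA

/-- **Nested tuples are good in every `(n,d)`, in any order**: if the `A_i` form a chain under inclusion then `0 ≤ sStarN n d A`.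
[this work] -/
theorem sStarN_nonneg_of_isChain {n : ℕ} (A : Fin n → Finset (Pn n d)) (hA : ∀ i j, A i ⊆ A j ∨ A j ⊆ A i) :
    0 ≤ sStarN n d A := by
  -- sort the slots by decreasing cardinality: for a chain this is decreasing inclusion
  let σ : Equiv.Perm (Fin n) := Tuple.sort fun i => (Fintype.card (Pn n d) - (A i).card : ℕ)
  have hmono : Monotone ((fun i => (Fintype.card (Pn n d) - (A i).card : ℕ)) ∘ σ) := Tuple.monotone_sort _
  rw [← sStarN_comp_perm σ A]
  refine sStarN_nonneg_of_antitone _ fun i j hij => ?_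
  have hcard : (A (σ j)).card ≤ (A (σ i)).card := by
    have h := hmono hij
    simp only [Function.comp_apply] at h
    have hi := Finset.card_le_univ (A (σ i))
    have hj := Finset.card_le_univ (A (σ j))
    omega
  rcases hA (σ i) (σ j) with h | h
  · exact (Finset.eq_of_subset_of_card_le h hcard).symm.subset
  · exact h

/-- Up-sets of the chain `[n]^1` are nested. [folklore] -/
theorem upperSet_dim_one_total {n : ℕ} {A B : Finset (Pn n 1)} (hA : IsUpperSet (A : Set (Pn n 1)))
    (hB : IsUpperSet (B : Set (Pn n 1))) : A ⊆ B ∨ B ⊆ A := by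
  by_contra h
  rw [not_or] at h
  obtain ⟨hAB, hBA⟩ := h
  rw [Finset.not_subset] at hAB hBA
  obtain ⟨x, hxA, hxB⟩ := hAB
  obtain ⟨y, hyB, hyA⟩ := hBA
  rcases le_total (x 0) (y 0) with hxy | hyx
  · have hle : x ≤ y := fun k => by rwa [Subsingleton.elim k 0]
    exact hyA (hA hle hxA)
  · have hle : y ≤ x := fun k => by rwa [Subsingleton.elim k 0]
    exact hxB (hB hle hyB)

/-- **The chain row: `PatternPosN n 1` for every `n`** (cells `(1,n)` — Blinovsky's chain theorem, coefficientwise, kernel). [this work] -/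
theorem patternPosN_dim_one (n : ℕ) : PatternPosN n 1 := fun A hA =>
  sStarN_nonneg_of_isChain A fun i j => upperSet_dim_one_total (hA i) (hA j)

end

end Summit.CriticalPhenomena.PercolationContinuityZ3.Theorems.SahiGridPatternN
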